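import Summits.QuantumFields.YangMills.Theorems.ColdStartUniversalityLatticeLangevinDossSussmannSmoothingThree
import Summits.QuantumFields.YangMills.Theorems.ColdStartUniversalityLatticeLangevinDossSussmannSmoothingTwoFlat
import HarnessLib

/-!
# Route `ColdStartUniversality` (fixed-cut-off SZZ dynamics; Doss–Sussmann smoothing programme, file 14):
# `P_t(C³) ⊂ C³_c` IN THE TREE'S FLAT REAL LINK COORDINATES — THE DYNKIN CLASS IS PRESERVED

Helper file (seat `ym-line-csu-p1`, g24).  The tree's test-function class for the SZZ Dynkin formula
(`dynkin_expectation_szz`) is `f ∘ coords` with `f : (Edge 3 L × Fin 2 × Fin 2 × Bool → ℝ) → ℝ`, `ContDiff ℝ 3 f`,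
`HasCompactSupport f`, in the REAL link coordinates `coords V q = Re/Im (V_{q.1})_{q.2.1 q.2.2.1}`.
★★★ `markovTransition_contDiff_three_flat`: for every `C³` such `f` there is a `C³`, COMPACTLY SUPPORTED `g` with
`𝔼 f(coords U^x_t) = g(coords x)` for all `x ∈ SU(2)^E` — the Markov transition operator of the SZZ dynamics at fixed
cut-off maps the Dynkin class into itself (from `markovTransition_contDiff_three`, file 13, by the real-linear coordinate
change and a bump equal to `1` on the unit sup-ball, file 10).
THEOREMS ONLY, no sorry.  HONEST FRAMING: fixed-cut-off regularity; nothing K-uniform; no crux, rung or summit statement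
is proved; the Yang–Mills mass gap is NOT proved.
-/

set_option autoImplicit false

noncomputable section

namespace Summit.QuantumFields.YangMills.Theorems.ColdStartUniversality

open MeasureTheory Finset Filter Set Metric Function
open scoped NNReal Matrix Topology
open Literature.MathematicalPhysics.QuantumFieldTheory
open Literature.MathematicalPhysics.QuantumLattice (fundamentalRep fundamentalLatticeRep continuous_fundamentalRep
  fundamentalRep_mem_unitaryGroup)

variable {L : ℕ}

/-- ★★★ **`P_t(C³) ⊂ C³_c` in flat coordinates.**  In the setting of `markovTransition_contDiff_three`: for every `C³`
function `f` of the real link coordinates there is a `C³`, compactly supported function `g` of the real link coordinates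
with `𝔼 f(coords U^x_t) = g(coords x)` for all `x ∈ SU(2)^E` — the transition operator maps the tree's `C³` cylinder
class into its compactly supported `C³` cylinder class — exactly the test-function class of `dynkin_expectation_szz`. [folklore] -/
theorem markovTransition_contDiff_three_flat [NeZero L] (β : ℝ)
    {Ω : Type} [MeasurableSpace Ω] {P : Measure Ω} [IsProbabilityMeasure P]
    {W : ℝ≥0 → Ω → (Edge 3 L × NoiseIdx 2 → ℝ)} (hW : IsFlatBrownian W P)
    (B U : GaugeConfig 3 L (Matrix.specialUnitaryGroup (Fin 2) ℂ) → ℝ≥0 → Ω →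
      GaugeConfig 3 L (Matrix.specialUnitaryGroup (Fin 2) ℂ))
    (hB : ∀ x, (∀ ω, B x 0 ω = x) ∧
      (latticeLangevinDynamics (fundamentalLatticeRep 2) 0).IsSolution (fundamentalRep (Fin 2)) hW.natFiltration P W (B x))
    (hBm : ∀ i : ℝ≥0, Measurable[@Prod.instMeasurableSpace (Set.Iic i)
        (GaugeConfig 3 L (Matrix.specialUnitaryGroup (Fin 2) ℂ) × Ω) inferInstance
        (@Prod.instMeasurableSpace (GaugeConfig 3 L (Matrix.specialUnitaryGroup (Fin 2) ℂ)) Ω inferInstance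
          (hW.natFiltration i))]
      (fun q : Set.Iic i × (GaugeConfig 3 L (Matrix.specialUnitaryGroup (Fin 2) ℂ) × Ω) => B q.2.1 q.1 q.2.2))
    (hU : ∀ x, (∀ ω, U x 0 ω = x) ∧
      (latticeLangevinDynamics (fundamentalLatticeRep 2) β).IsSolution (fundamentalRep (Fin 2)) hW.natFiltration P W (U x))
    (hUm : ∀ i : ℝ≥0, Measurable[@Prod.instMeasurableSpace (Set.Iic i)
        (GaugeConfig 3 L (Matrix.specialUnitaryGroup (Fin 2) ℂ) × Ω) inferInstance
        (@Prod.instMeasurableSpace (GaugeConfig 3 L (Matrix.specialUnitaryGroup (Fin 2) ℂ)) Ω inferInstance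
          (hW.natFiltration i))]
      (fun q : Set.Iic i × (GaugeConfig 3 L (Matrix.specialUnitaryGroup (Fin 2) ℂ) × Ω) => U q.2.1 q.1 q.2.2))
    (t : ℝ≥0) {f : (Edge 3 L × Fin 2 × Fin 2 × Bool → ℝ) → ℝ} (hf : ContDiff ℝ 3 f) :
    ∃ g : (Edge 3 L × Fin 2 × Fin 2 × Bool → ℝ) → ℝ, ContDiff ℝ 3 g ∧ HasCompactSupport g ∧
      ∀ x : GaugeConfig 3 L (Matrix.specialUnitaryGroup (Fin 2) ℂ),
        ∫ ω, f (fun q : Edge 3 L × Fin 2 × Fin 2 × Bool => (fun z : ℂ => if q.2.2.2 then z.im else z.re)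
            ((fundamentalRep (Fin 2) (U x t ω q.1) : Matrix (Fin 2) (Fin 2) ℂ) q.2.1 q.2.2.1)) ∂P =
          g (fun q : Edge 3 L × Fin 2 × Fin 2 × Bool => (fun z : ℂ => if q.2.2.2 then z.im else z.re)
            ((fundamentalRep (Fin 2) (x q.1) : Matrix (Fin 2) (Fin 2) ℂ) q.2.1 q.2.2.1)) := by
  -- the two coordinate changes
  obtain ⟨θ, hθ⟩ : ∃ θ : (Edge 3 L → Fin (fundamentalLatticeRep 2).N → Fin (fundamentalLatticeRep 2).N → ℂ) →
      (Edge 3 L × Fin 2 × Fin 2 × Bool → ℝ),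
      θ = fun M q => (fun z : ℂ => if q.2.2.2 then z.im else z.re) (M q.1 q.2.1 q.2.2.1) := ⟨_, rfl⟩
  obtain ⟨ψ, hψ⟩ : ∃ ψ : (Edge 3 L × Fin 2 × Fin 2 × Bool → ℝ) →
      (Edge 3 L → Fin (fundamentalLatticeRep 2).N → Fin (fundamentalLatticeRep 2).N → ℂ),
      ψ = fun y e k l => (⟨y (e, k, l, false), y (e, k, l, true)⟩ : ℂ) := ⟨_, rfl⟩
  have hθs : ContDiff ℝ 3 θ := by rw [hθ]; exact contDiff_toFlat (L := L)
  have hψs : ContDiff ℝ 3 ψ := by rw [hψ]; exact contDiff_ofFlat (L := L)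
  have hψθ : ∀ M, ψ (θ M) = M := fun M => by
    rw [hψ, hθ]; funext e k l
    exact Complex.ext rfl rfl
  obtain ⟨g, hg, hgU⟩ := markovTransition_contDiff_three (L := L) β hW B U hB hBm hU hUm t (f := f ∘ θ) (hf.comp hθs)
  obtain ⟨g', hg's, hg'c, hg'eq⟩ := exists_compactSupport_eqOn_unitBall (L := L) (hg.comp hψs)
  refine ⟨g', hg's, hg'c, fun x => ?_⟩
  have h1 := hgU x
  have hcoords : ∀ V : GaugeConfig 3 L (Matrix.specialUnitaryGroup (Fin 2) ℂ),
      θ (fun (e : Edge 3 L) (k l : Fin (fundamentalLatticeRep 2).N) => (fundamentalLatticeRep 2).ρ (V e) k l) =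
        fun q : Edge 3 L × Fin 2 × Fin 2 × Bool => (fun z : ℂ => if q.2.2.2 then z.im else z.re)
          ((fundamentalRep (Fin 2) (V q.1) : Matrix (Fin 2) (Fin 2) ℂ) q.2.1 q.2.2.1) := fun V => by
    rw [hθ]; rfl
  simp only [Function.comp_apply, hcoords] at h1
  rw [h1, hg'eq _ (norm_flatCoords_le_one (L := L) x), Function.comp_apply, ← hcoords x, hψθ]

end Summit.QuantumFields.YangMills.Theorems.ColdStartUniversality

end
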